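import Mathlib.Tactic.Ring
import Mathlib.Tactic.Linarith
import Mathlib.Tactic.Positivity
import Mathlib.Tactic.LinearCombination
import Mathlib.Data.Real.Basic
import HarnessLib

/-!
# Conjecture N (hodge-weil ladder, GAPS G51b), format (4,2): THE SIGN LAW — exactly two E-roots are escapable

Prover 2, generation 12 (note `run/shared/lean/b2b/hodge-weil/b2b-hweil-pv2-g12/VERTEX-FORM-G12.md` §3 and ADDENDUM 1). Companion of
`WeilClassTestWallFactorisation.lean` (same seat; the two identities it needs are re-derived here so that the file is self-contained).
Setting (`CONJECTURE-N.md` §1, real charges, format (4,2)): E-charges `u₁..u₄`, F-charges `v₁, v₂`, centred `Σu = Σv` (h1) and (P4)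
`Σu³ = Σv³` (h3); `S := Σu² − v₁² − v₂²` (the centred `S_u`); the WALL FUNCTION of a root is `w_k := 2u_k² − S` (E) / `2v_f² − S` (F).
Generation 11 observed (`CROSS-MAX-G11.md` §2.4; 432/432 realisable charge vectors) that EXACTLY TWO of `w₁..w₄` are positive. THEOREM here:
(A) charge-only: `σ⁴∏_e w_e = 16∏_{e<e'}(u_e+u_{e'})² ≥ 0` (parity; in `WeilClassTestWallFactorisation`), and — NEW — if all four `w_e` have the
same strict sign then so do `w₅, w₆` (`F_walls_pos_of_E_walls_pos`, `F_walls_neg_of_E_walls_neg`): with `σ = Σu`, `e₂, e₃` of the E-charges,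
`σ²·(v₁² − S/2)(v₂² − S/2) = σ³e₃ + (σe₂ − 2e₃)² = Σ_M C_M (X_M² + (2/3)X_MY_M + Y_M²)` over the three perfect matchings
`M = {{e,e'},{e'',e'''}}` of the E-roots, `X_M = u_e+u_{e'}`, `Y_M = u_{e''}+u_{e'''}`, `C_M` the product of the four cross pair-sums, and
`σ²w_ew_{e'} = 4(u_e+u_{e'})²C_M` forces every `C_M > 0`. (B) position input: in the vertex gauge (P2) is `Σ_k s_k w_k = 0` with heights
`s_k = ε_k(y_k − yV) ≥ 0` over any level `yV` separating F from E; so a dominant configuration satisfying (P2) with one root off the level cannot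
have six walls of one strict sign. (A)+(B): for such configurations with `σ ≠ 0`, NOT all four E-walls positive, NOT all four negative, and
their product is `≥ 0` — i.e. whenever no E-wall vanishes, exactly two are positive (`sign_law`). Pure algebra; nothing here is a rung, a door
edge or a cited fact; no statement of Markman's papers is used. New cell result ⇒ Summits/.
-/

set_option linter.dupNamespace false

namespace Summit.HodgeConjecture.HodgeConjecture.WeilClassTestSignLaw

/-- `σ·(v₁v₂) = σe₂ − e₃`: the F-charges are the roots of `t² − σt + (e₂ − e₃/σ)` (centring + (P4)). -/
theorem sigma_mul_prodF (u₁ u₂ u₃ u₄ v₁ v₂ : ℝ) (h1 : u₁ + u₂ + u₃ + u₄ = v₁ + v₂)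
    (h3 : u₁ ^ 3 + u₂ ^ 3 + u₃ ^ 3 + u₄ ^ 3 = v₁ ^ 3 + v₂ ^ 3) :
    (u₁ + u₂ + u₃ + u₄) * (v₁ * v₂)
      = (u₁ + u₂ + u₃ + u₄) * (u₁ * u₂ + u₁ * u₃ + u₁ * u₄ + u₂ * u₃ + u₂ * u₄ + u₃ * u₄)
        - (u₁ * u₂ * u₃ + u₁ * u₂ * u₄ + u₁ * u₃ * u₄ + u₂ * u₃ * u₄) := by
  linear_combination
    (v₁ * v₂ - ((u₁ + u₂ + u₃ + u₄) ^ 2 + (u₁ + u₂ + u₃ + u₄) * (v₁ + v₂) + (v₁ + v₂) ^ 2) / 3) * h1 + (1 / 3) * h3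

/-- THE MATCHING FORM: `σ²·(v₁² − S/2)(v₂² − S/2) = Σ_M C_M·(X_M² + (2/3)X_MY_M + Y_M²)` over the three perfect matchings of the
E-roots (equivalently `= σ³e₃ + (σe₂ − 2e₃)²`), for centred (P4)-pure charges. -/
theorem prodF_walls_matching_form (u₁ u₂ u₃ u₄ v₁ v₂ S : ℝ) (hS : S = u₁ ^ 2 + u₂ ^ 2 + u₃ ^ 2 + u₄ ^ 2 - v₁ ^ 2 - v₂ ^ 2)
    (h1 : u₁ + u₂ + u₃ + u₄ = v₁ + v₂) (h3 : u₁ ^ 3 + u₂ ^ 3 + u₃ ^ 3 + u₄ ^ 3 = v₁ ^ 3 + v₂ ^ 3) :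
    (u₁ + u₂ + u₃ + u₄) ^ 2 * ((v₁ ^ 2 - S / 2) * (v₂ ^ 2 - S / 2))
      = (u₁ + u₃) * (u₁ + u₄) * (u₂ + u₃) * (u₂ + u₄) * ((u₁ + u₂) ^ 2 + 2 / 3 * (u₁ + u₂) * (u₃ + u₄) + (u₃ + u₄) ^ 2)
        + (u₁ + u₂) * (u₁ + u₄) * (u₃ + u₂) * (u₃ + u₄) * ((u₁ + u₃) ^ 2 + 2 / 3 * (u₁ + u₃) * (u₂ + u₄) + (u₂ + u₄) ^ 2)
        + (u₁ + u₂) * (u₁ + u₃) * (u₄ + u₂) * (u₄ + u₃) * ((u₁ + u₄) ^ 2 + 2 / 3 * (u₁ + u₄) * (u₂ + u₃) + (u₂ + u₃) ^ 2) := by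
  subst hS
  have hπ := sigma_mul_prodF u₁ u₂ u₃ u₄ v₁ v₂ h1 h3
  -- σ²·v₅v₆ − T = −R·(σ − τ) + (4D + 4σe₂ − 8e₃ − σ³)·D, with D = hπ.lhs − hπ.rhs and R as in the note (ADDENDUM 1)
  linear_combination
    (-((u₁ + u₂ + u₃ + u₄) ^ 2 * ((v₁ + v₂) + (u₁ + u₂ + u₃ + u₄))
        * (3 / 4 * ((v₁ + v₂) ^ 2 + (u₁ + u₂ + u₃ + u₄) ^ 2 - 4 * (v₁ * v₂)) - (u₁ ^ 2 + u₂ ^ 2 + u₃ ^ 2 + u₄ ^ 2)))) * h1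
    + (4 * ((u₁ + u₂ + u₃ + u₄) * (v₁ * v₂)
            - ((u₁ + u₂ + u₃ + u₄) * (u₁ * u₂ + u₁ * u₃ + u₁ * u₄ + u₂ * u₃ + u₂ * u₄ + u₃ * u₄)
              - (u₁ * u₂ * u₃ + u₁ * u₂ * u₄ + u₁ * u₃ * u₄ + u₂ * u₃ * u₄)))
        + 4 * ((u₁ + u₂ + u₃ + u₄) * (u₁ * u₂ + u₁ * u₃ + u₁ * u₄ + u₂ * u₃ + u₂ * u₄ + u₃ * u₄))
        - 8 * (u₁ * u₂ * u₃ + u₁ * u₂ * u₄ + u₁ * u₃ * u₄ + u₂ * u₃ * u₄) - (u₁ + u₂ + u₃ + u₄) ^ 3) * hπ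

/-- The wall of `E₁` times `σ` is twice the product of the pair sums at `E₁` (re-derived from `WeilClassTestWallFactorisation`). -/
theorem wall₁ (u₁ u₂ u₃ u₄ v₁ v₂ : ℝ) (h1 : u₁ + u₂ + u₃ + u₄ = v₁ + v₂)
    (h3 : u₁ ^ 3 + u₂ ^ 3 + u₃ ^ 3 + u₄ ^ 3 = v₁ ^ 3 + v₂ ^ 3) :
    (u₁ + u₂ + u₃ + u₄) * (2 * u₁ ^ 2 - (u₁ ^ 2 + u₂ ^ 2 + u₃ ^ 2 + u₄ ^ 2 - v₁ ^ 2 - v₂ ^ 2))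
      = 2 * ((u₁ + u₂) * (u₁ + u₃) * (u₁ + u₄)) := by
  linear_combination
    (-(((u₁ + u₂ + u₃ + u₄) ^ 2 + (u₁ + u₂ + u₃ + u₄) * (v₁ + v₂) + (v₁ + v₂) ^ 2) / 3 - (v₁ ^ 2 + v₂ ^ 2))) * h1
      - (2 / 3) * h3

/-- Same for `E₂`. -/
theorem wall₂ (u₁ u₂ u₃ u₄ v₁ v₂ : ℝ) (h1 : u₁ + u₂ + u₃ + u₄ = v₁ + v₂)
    (h3 : u₁ ^ 3 + u₂ ^ 3 + u₃ ^ 3 + u₄ ^ 3 = v₁ ^ 3 + v₂ ^ 3) :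
    (u₁ + u₂ + u₃ + u₄) * (2 * u₂ ^ 2 - (u₁ ^ 2 + u₂ ^ 2 + u₃ ^ 2 + u₄ ^ 2 - v₁ ^ 2 - v₂ ^ 2))
      = 2 * ((u₂ + u₁) * (u₂ + u₃) * (u₂ + u₄)) := by
  linear_combination
    (-(((u₁ + u₂ + u₃ + u₄) ^ 2 + (u₁ + u₂ + u₃ + u₄) * (v₁ + v₂) + (v₁ + v₂) ^ 2) / 3 - (v₁ ^ 2 + v₂ ^ 2))) * h1
      - (2 / 3) * h3

/-- Same for `E₃`. -/
theorem wall₃ (u₁ u₂ u₃ u₄ v₁ v₂ : ℝ) (h1 : u₁ + u₂ + u₃ + u₄ = v₁ + v₂)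
    (h3 : u₁ ^ 3 + u₂ ^ 3 + u₃ ^ 3 + u₄ ^ 3 = v₁ ^ 3 + v₂ ^ 3) :
    (u₁ + u₂ + u₃ + u₄) * (2 * u₃ ^ 2 - (u₁ ^ 2 + u₂ ^ 2 + u₃ ^ 2 + u₄ ^ 2 - v₁ ^ 2 - v₂ ^ 2))
      = 2 * ((u₃ + u₁) * (u₃ + u₂) * (u₃ + u₄)) := by
  linear_combination
    (-(((u₁ + u₂ + u₃ + u₄) ^ 2 + (u₁ + u₂ + u₃ + u₄) * (v₁ + v₂) + (v₁ + v₂) ^ 2) / 3 - (v₁ ^ 2 + v₂ ^ 2))) * h1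
      - (2 / 3) * h3

/-- Same for `E₄`. -/
theorem wall₄ (u₁ u₂ u₃ u₄ v₁ v₂ : ℝ) (h1 : u₁ + u₂ + u₃ + u₄ = v₁ + v₂)
    (h3 : u₁ ^ 3 + u₂ ^ 3 + u₃ ^ 3 + u₄ ^ 3 = v₁ ^ 3 + v₂ ^ 3) :
    (u₁ + u₂ + u₃ + u₄) * (2 * u₄ ^ 2 - (u₁ ^ 2 + u₂ ^ 2 + u₃ ^ 2 + u₄ ^ 2 - v₁ ^ 2 - v₂ ^ 2))
      = 2 * ((u₄ + u₁) * (u₄ + u₂) * (u₄ + u₃)) := by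
  linear_combination
    (-(((u₁ + u₂ + u₃ + u₄) ^ 2 + (u₁ + u₂ + u₃ + u₄) * (v₁ + v₂) + (v₁ + v₂) ^ 2) / 3 - (v₁ ^ 2 + v₂ ^ 2))) * h1
      - (2 / 3) * h3

/-- Elementary: `ab > 0` and `a + b > 0` force `a, b > 0`. -/
theorem both_pos_of_mul_pos_of_add_pos (a b : ℝ) (hm : 0 < a * b) (hs : 0 < a + b) : 0 < a ∧ 0 < b := by
  rcases pos_and_pos_or_neg_and_neg_of_mul_pos hm with h | ⟨ha, hb⟩
  · exact h
  · exfalso; linarith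

/-- Elementary: `ab > 0` and `a + b < 0` force `a, b < 0`. -/
theorem both_neg_of_mul_pos_of_add_neg (a b : ℝ) (hm : 0 < a * b) (hs : a + b < 0) : a < 0 ∧ b < 0 := by
  rcases pos_and_pos_or_neg_and_neg_of_mul_pos hm with ⟨ha, hb⟩ | h
  · exfalso; linarith
  · exact h

/-- Elementary: a product `s·w = 0` with `w ≠ 0` has `s = 0`. -/
theorem height_zero_of_mul_wall (s w : ℝ) (hw : w ≠ 0) (h : s * w = 0) : s = 0 := by
  rcases mul_eq_zero.mp h with h | h
  · exact h
  · exact absurd h hw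

/-- (A) If the four E-walls are of one strict sign (their pairwise products are positive) and `σ ≠ 0`, then the product of the two F-walls
is positive. Mechanism: `σ²w_ew_{e'} = 4(u_e+u_{e'})²·C_M > 0` gives `C_M > 0` for each matching, then the matching form. -/
theorem prodF_walls_pos (u₁ u₂ u₃ u₄ v₁ v₂ S : ℝ) (hS : S = u₁ ^ 2 + u₂ ^ 2 + u₃ ^ 2 + u₄ ^ 2 - v₁ ^ 2 - v₂ ^ 2)
    (hσ : u₁ + u₂ + u₃ + u₄ ≠ 0) (h1 : u₁ + u₂ + u₃ + u₄ = v₁ + v₂)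
    (h3 : u₁ ^ 3 + u₂ ^ 3 + u₃ ^ 3 + u₄ ^ 3 = v₁ ^ 3 + v₂ ^ 3)
    (h12 : 0 < (2 * u₁ ^ 2 - S) * (2 * u₂ ^ 2 - S)) (h13 : 0 < (2 * u₁ ^ 2 - S) * (2 * u₃ ^ 2 - S))
    (h14 : 0 < (2 * u₁ ^ 2 - S) * (2 * u₄ ^ 2 - S)) :
    0 < (2 * v₁ ^ 2 - S) * (2 * v₂ ^ 2 - S) := by
  have w1 : (u₁ + u₂ + u₃ + u₄) * (2 * u₁ ^ 2 - S) = 2 * ((u₁ + u₂) * (u₁ + u₃) * (u₁ + u₄)) := by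
    subst hS; exact wall₁ u₁ u₂ u₃ u₄ v₁ v₂ h1 h3
  have w2 : (u₁ + u₂ + u₃ + u₄) * (2 * u₂ ^ 2 - S) = 2 * ((u₂ + u₁) * (u₂ + u₃) * (u₂ + u₄)) := by
    subst hS; exact wall₂ u₁ u₂ u₃ u₄ v₁ v₂ h1 h3
  have w3 : (u₁ + u₂ + u₃ + u₄) * (2 * u₃ ^ 2 - S) = 2 * ((u₃ + u₁) * (u₃ + u₂) * (u₃ + u₄)) := by
    subst hS; exact wall₃ u₁ u₂ u₃ u₄ v₁ v₂ h1 h3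
  have w4 : (u₁ + u₂ + u₃ + u₄) * (2 * u₄ ^ 2 - S) = 2 * ((u₄ + u₁) * (u₄ + u₂) * (u₄ + u₃)) := by
    subst hS; exact wall₄ u₁ u₂ u₃ u₄ v₁ v₂ h1 h3
  have hσ2 : 0 < (u₁ + u₂ + u₃ + u₄) ^ 2 := by positivity
  -- the three cross products C_M are positive
  have c12 : 0 < (u₁ + u₃) * (u₁ + u₄) * (u₂ + u₃) * (u₂ + u₄) := by
    have e : (u₁ + u₂ + u₃ + u₄) ^ 2 * ((2 * u₁ ^ 2 - S) * (2 * u₂ ^ 2 - S))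
        = 4 * (u₁ + u₂) ^ 2 * ((u₁ + u₃) * (u₁ + u₄) * (u₂ + u₃) * (u₂ + u₄)) := by
      have : (u₁ + u₂ + u₃ + u₄) ^ 2 * ((2 * u₁ ^ 2 - S) * (2 * u₂ ^ 2 - S))
          = ((u₁ + u₂ + u₃ + u₄) * (2 * u₁ ^ 2 - S)) * ((u₁ + u₂ + u₃ + u₄) * (2 * u₂ ^ 2 - S)) := by ring
      rw [this, w1, w2]; ring
    have hpos : 0 < 4 * (u₁ + u₂) ^ 2 * ((u₁ + u₃) * (u₁ + u₄) * (u₂ + u₃) * (u₂ + u₄)) := by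
      rw [← e]; exact mul_pos hσ2 h12
    exact pos_of_mul_pos_right hpos (by positivity)
  have c13 : 0 < (u₁ + u₂) * (u₁ + u₄) * (u₃ + u₂) * (u₃ + u₄) := by
    have e : (u₁ + u₂ + u₃ + u₄) ^ 2 * ((2 * u₁ ^ 2 - S) * (2 * u₃ ^ 2 - S))
        = 4 * (u₁ + u₃) ^ 2 * ((u₁ + u₂) * (u₁ + u₄) * (u₃ + u₂) * (u₃ + u₄)) := by
      have : (u₁ + u₂ + u₃ + u₄) ^ 2 * ((2 * u₁ ^ 2 - S) * (2 * u₃ ^ 2 - S))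
          = ((u₁ + u₂ + u₃ + u₄) * (2 * u₁ ^ 2 - S)) * ((u₁ + u₂ + u₃ + u₄) * (2 * u₃ ^ 2 - S)) := by ring
      rw [this, w1, w3]; ring
    have hpos : 0 < 4 * (u₁ + u₃) ^ 2 * ((u₁ + u₂) * (u₁ + u₄) * (u₃ + u₂) * (u₃ + u₄)) := by
      rw [← e]; exact mul_pos hσ2 h13
    exact pos_of_mul_pos_right hpos (by positivity)
  have c14 : 0 < (u₁ + u₂) * (u₁ + u₃) * (u₄ + u₂) * (u₄ + u₃) := by
    have e : (u₁ + u₂ + u₃ + u₄) ^ 2 * ((2 * u₁ ^ 2 - S) * (2 * u₄ ^ 2 - S))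
        = 4 * (u₁ + u₄) ^ 2 * ((u₁ + u₂) * (u₁ + u₃) * (u₄ + u₂) * (u₄ + u₃)) := by
      have : (u₁ + u₂ + u₃ + u₄) ^ 2 * ((2 * u₁ ^ 2 - S) * (2 * u₄ ^ 2 - S))
          = ((u₁ + u₂ + u₃ + u₄) * (2 * u₁ ^ 2 - S)) * ((u₁ + u₂ + u₃ + u₄) * (2 * u₄ ^ 2 - S)) := by ring
      rw [this, w1, w4]; ring
    have hpos : 0 < 4 * (u₁ + u₄) ^ 2 * ((u₁ + u₂) * (u₁ + u₃) * (u₄ + u₂) * (u₄ + u₃)) := by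
      rw [← e]; exact mul_pos hσ2 h14
    exact pos_of_mul_pos_right hpos (by positivity)
  -- the three quadratic factors are non-negative and the first is positive because σ = X + Y ≠ 0
  have q12 : 0 < (u₁ + u₂) ^ 2 + 2 / 3 * (u₁ + u₂) * (u₃ + u₄) + (u₃ + u₄) ^ 2 := by
    -- = ¼σ² + ¾(X + Y/9)² + (20/27)Y² with X = u₁+u₂, Y = u₃+u₄, σ = X + Y
    linarith [sq_nonneg ((u₁ + u₂) + (u₃ + u₄) / 9), sq_nonneg (u₃ + u₄), hσ2]
  have q13 : 0 ≤ (u₁ + u₃) ^ 2 + 2 / 3 * (u₁ + u₃) * (u₂ + u₄) + (u₂ + u₄) ^ 2 := by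
    linarith [sq_nonneg ((u₁ + u₃) + (u₂ + u₄) / 3), sq_nonneg (u₂ + u₄)]
  have q14 : 0 ≤ (u₁ + u₄) ^ 2 + 2 / 3 * (u₁ + u₄) * (u₂ + u₃) + (u₂ + u₃) ^ 2 := by
    linarith [sq_nonneg ((u₁ + u₄) + (u₂ + u₃) / 3), sq_nonneg (u₂ + u₃)]
  have key := prodF_walls_matching_form u₁ u₂ u₃ u₄ v₁ v₂ S hS h1 h3
  have hT : 0 < (u₁ + u₂ + u₃ + u₄) ^ 2 * ((v₁ ^ 2 - S / 2) * (v₂ ^ 2 - S / 2)) := by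
    rw [key]
    have t1 := mul_pos c12 q12
    have t2 := mul_nonneg c13.le q13
    have t3 := mul_nonneg c14.le q14
    linarith
  have hv : 0 < (v₁ ^ 2 - S / 2) * (v₂ ^ 2 - S / 2) := (mul_pos_iff_of_pos_left hσ2).mp hT
  have e4 : (2 * v₁ ^ 2 - S) * (2 * v₂ ^ 2 - S) = 4 * ((v₁ ^ 2 - S / 2) * (v₂ ^ 2 - S / 2)) := by ring
  rw [e4]; positivity

/-- The wall functions of all six roots sum to zero with signs: `Σ_E w_e = Σ_F w_f` (no hypothesis needed). -/
theorem walls_sum (u₁ u₂ u₃ u₄ v₁ v₂ S : ℝ) (hS : S = u₁ ^ 2 + u₂ ^ 2 + u₃ ^ 2 + u₄ ^ 2 - v₁ ^ 2 - v₂ ^ 2) :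
    (2 * u₁ ^ 2 - S) + (2 * u₂ ^ 2 - S) + (2 * u₃ ^ 2 - S) + (2 * u₄ ^ 2 - S) = (2 * v₁ ^ 2 - S) + (2 * v₂ ^ 2 - S) := by
  subst hS; ring

/-- (A⁺) All four E-walls positive (and `σ ≠ 0`) ⇒ both F-walls positive. -/
theorem F_walls_pos_of_E_walls_pos (u₁ u₂ u₃ u₄ v₁ v₂ S : ℝ) (hS : S = u₁ ^ 2 + u₂ ^ 2 + u₃ ^ 2 + u₄ ^ 2 - v₁ ^ 2 - v₂ ^ 2)
    (hσ : u₁ + u₂ + u₃ + u₄ ≠ 0)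
    (h1 : u₁ + u₂ + u₃ + u₄ = v₁ + v₂) (h3 : u₁ ^ 3 + u₂ ^ 3 + u₃ ^ 3 + u₄ ^ 3 = v₁ ^ 3 + v₂ ^ 3)
    (hw1 : 0 < 2 * u₁ ^ 2 - S) (hw2 : 0 < 2 * u₂ ^ 2 - S) (hw3 : 0 < 2 * u₃ ^ 2 - S) (hw4 : 0 < 2 * u₄ ^ 2 - S) :
    0 < 2 * v₁ ^ 2 - S ∧ 0 < 2 * v₂ ^ 2 - S := by
  have hp := prodF_walls_pos u₁ u₂ u₃ u₄ v₁ v₂ S hS hσ h1 h3 (mul_pos hw1 hw2) (mul_pos hw1 hw3) (mul_pos hw1 hw4)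
  have hs := walls_sum u₁ u₂ u₃ u₄ v₁ v₂ S hS
  have hsum : 0 < (2 * v₁ ^ 2 - S) + (2 * v₂ ^ 2 - S) := by linarith
  exact both_pos_of_mul_pos_of_add_pos _ _ hp hsum

/-- (A⁻) All four E-walls negative (and `σ ≠ 0`) ⇒ both F-walls negative. -/
theorem F_walls_neg_of_E_walls_neg (u₁ u₂ u₃ u₄ v₁ v₂ S : ℝ) (hS : S = u₁ ^ 2 + u₂ ^ 2 + u₃ ^ 2 + u₄ ^ 2 - v₁ ^ 2 - v₂ ^ 2)
    (hσ : u₁ + u₂ + u₃ + u₄ ≠ 0)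
    (h1 : u₁ + u₂ + u₃ + u₄ = v₁ + v₂) (h3 : u₁ ^ 3 + u₂ ^ 3 + u₃ ^ 3 + u₄ ^ 3 = v₁ ^ 3 + v₂ ^ 3)
    (hw1 : 2 * u₁ ^ 2 - S < 0) (hw2 : 2 * u₂ ^ 2 - S < 0) (hw3 : 2 * u₃ ^ 2 - S < 0) (hw4 : 2 * u₄ ^ 2 - S < 0) :
    2 * v₁ ^ 2 - S < 0 ∧ 2 * v₂ ^ 2 - S < 0 := by
  have hp := prodF_walls_pos u₁ u₂ u₃ u₄ v₁ v₂ S hS hσ h1 h3 (mul_pos_of_neg_of_neg hw1 hw2)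
    (mul_pos_of_neg_of_neg hw1 hw3) (mul_pos_of_neg_of_neg hw1 hw4)
  have hs := walls_sum u₁ u₂ u₃ u₄ v₁ v₂ S hS
  have hsum : (2 * v₁ ^ 2 - S) + (2 * v₂ ^ 2 - S) < 0 := by linarith
  exact both_neg_of_mul_pos_of_add_neg _ _ hp hsum

/-- (B) (P2) IN THE VERTEX GAUGE, with wall functions: for any level `yV`, `2·Σε Y_kZ_k² = Σ_k s_k w_k` where `s_k = ε_k(y_k − yV)`,
`Y, Z` the mass-2 centred positions/charges, `w_k = 2Z_k² − S_u` (identity). For centred charges (`Σu = Σv`) `Z = u` and this is the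
vertex-gauge form of (P2) used below. -/
theorem P2_eq_half_sum_heights_mul_walls (y₁ y₂ y₃ y₄ y₅ y₆ u₁ u₂ u₃ u₄ u₅ u₆ yV : ℝ) :
    let yb : ℝ := (y₁ + y₂ + y₃ + y₄ - y₅ - y₆) / 2
    let ub : ℝ := (u₁ + u₂ + u₃ + u₄ - u₅ - u₆) / 2
    let Sz : ℝ := (u₁ - ub) ^ 2 + (u₂ - ub) ^ 2 + (u₃ - ub) ^ 2 + (u₄ - ub) ^ 2 - ((u₅ - ub) ^ 2 + (u₆ - ub) ^ 2)
    let P2 : ℝ := (y₁ - yb) * (u₁ - ub) ^ 2 + (y₂ - yb) * (u₂ - ub) ^ 2 + (y₃ - yb) * (u₃ - ub) ^ 2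
      + (y₄ - yb) * (u₄ - ub) ^ 2 - ((y₅ - yb) * (u₅ - ub) ^ 2 + (y₆ - yb) * (u₆ - ub) ^ 2)
    2 * P2 = (y₁ - yV) * (2 * (u₁ - ub) ^ 2 - Sz) + (y₂ - yV) * (2 * (u₂ - ub) ^ 2 - Sz)
      + (y₃ - yV) * (2 * (u₃ - ub) ^ 2 - Sz) + (y₄ - yV) * (2 * (u₄ - ub) ^ 2 - Sz)
      + (yV - y₅) * (2 * (u₅ - ub) ^ 2 - Sz) + (yV - y₆) * (2 * (u₆ - ub) ^ 2 - Sz) := by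
  intro yb ub Sz P2
  simp only [P2, Sz, ub, yb]
  ring

/-- **THE SIGN LAW.** Format (4,2), real charges, centred (`Σu = Σv`), (P4), `σ = Σu ≠ 0`; positions DOMINANT with respect to a level
`yV` (`y_e ≥ yV ≥ y_f`), NOT all on the level (`Σ_k s_k > 0`), and (P2). Then the four E-walls `w_e = 2u_e² − S_u` are NOT all positive,
NOT all negative, and their product is `≥ 0` — so when none of them vanishes exactly two are positive (the two 'confined' E-roots of
`CROSS-MAX-G11.md` §3.6, `S_ζ^{(e)} = −w_e < 0`; the other two, `w_e < 0`, are the escapable ones; the F-walls then follow from `walls_sum`). -/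
theorem sign_law (y₁ y₂ y₃ y₄ y₅ y₆ u₁ u₂ u₃ u₄ v₁ v₂ yV S : ℝ)
    (hS : S = u₁ ^ 2 + u₂ ^ 2 + u₃ ^ 2 + u₄ ^ 2 - v₁ ^ 2 - v₂ ^ 2) (hσ : u₁ + u₂ + u₃ + u₄ ≠ 0)
    (h1 : u₁ + u₂ + u₃ + u₄ = v₁ + v₂) (h3 : u₁ ^ 3 + u₂ ^ 3 + u₃ ^ 3 + u₄ ^ 3 = v₁ ^ 3 + v₂ ^ 3)
    (d₁ : yV ≤ y₁) (d₂ : yV ≤ y₂) (d₃ : yV ≤ y₃) (d₄ : yV ≤ y₄) (d₅ : y₅ ≤ yV) (d₆ : y₆ ≤ yV)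
    (hoff : 0 < (y₁ - yV) + (y₂ - yV) + (y₃ - yV) + (y₄ - yV) + (yV - y₅) + (yV - y₆))
    (hP2 : (y₁ - (y₁ + y₂ + y₃ + y₄ - y₅ - y₆) / 2) * u₁ ^ 2 + (y₂ - (y₁ + y₂ + y₃ + y₄ - y₅ - y₆) / 2) * u₂ ^ 2
      + (y₃ - (y₁ + y₂ + y₃ + y₄ - y₅ - y₆) / 2) * u₃ ^ 2 + (y₄ - (y₁ + y₂ + y₃ + y₄ - y₅ - y₆) / 2) * u₄ ^ 2
      - ((y₅ - (y₁ + y₂ + y₃ + y₄ - y₅ - y₆) / 2) * v₁ ^ 2 + (y₆ - (y₁ + y₂ + y₃ + y₄ - y₅ - y₆) / 2) * v₂ ^ 2) = 0) :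
    ¬ (0 < 2 * u₁ ^ 2 - S ∧ 0 < 2 * u₂ ^ 2 - S ∧ 0 < 2 * u₃ ^ 2 - S ∧ 0 < 2 * u₄ ^ 2 - S)
    ∧ ¬ (2 * u₁ ^ 2 - S < 0 ∧ 2 * u₂ ^ 2 - S < 0 ∧ 2 * u₃ ^ 2 - S < 0 ∧ 2 * u₄ ^ 2 - S < 0)
    ∧ 0 ≤ (2 * u₁ ^ 2 - S) * (2 * u₂ ^ 2 - S) * (2 * u₃ ^ 2 - S) * (2 * u₄ ^ 2 - S) := by
  -- (P2) in the vertex gauge: Σ_k s_k w_k = 0 (the charges are centred, so the centred charges are `u, v` themselves)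
  have hid : 0 = (y₁ - yV) * (2 * u₁ ^ 2 - S) + (y₂ - yV) * (2 * u₂ ^ 2 - S) + (y₃ - yV) * (2 * u₃ ^ 2 - S)
      + (y₄ - yV) * (2 * u₄ ^ 2 - S) + (yV - y₅) * (2 * v₁ ^ 2 - S) + (yV - y₆) * (2 * v₂ ^ 2 - S) := by
    subst hS
    linear_combination (-2 : ℝ) * hP2
  have w1 : (u₁ + u₂ + u₃ + u₄) * (2 * u₁ ^ 2 - S) = 2 * ((u₁ + u₂) * (u₁ + u₃) * (u₁ + u₄)) := by
    subst hS; exact wall₁ u₁ u₂ u₃ u₄ v₁ v₂ h1 h3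
  have w2 : (u₁ + u₂ + u₃ + u₄) * (2 * u₂ ^ 2 - S) = 2 * ((u₂ + u₁) * (u₂ + u₃) * (u₂ + u₄)) := by
    subst hS; exact wall₂ u₁ u₂ u₃ u₄ v₁ v₂ h1 h3
  have w3 : (u₁ + u₂ + u₃ + u₄) * (2 * u₃ ^ 2 - S) = 2 * ((u₃ + u₁) * (u₃ + u₂) * (u₃ + u₄)) := by
    subst hS; exact wall₃ u₁ u₂ u₃ u₄ v₁ v₂ h1 h3
  have w4 : (u₁ + u₂ + u₃ + u₄) * (2 * u₄ ^ 2 - S) = 2 * ((u₄ + u₁) * (u₄ + u₂) * (u₄ + u₃)) := by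
    subst hS; exact wall₄ u₁ u₂ u₃ u₄ v₁ v₂ h1 h3
  refine ⟨?_, ?_, ?_⟩
  · rintro ⟨a1, a2, a3, a4⟩
    obtain ⟨a5, a6⟩ := F_walls_pos_of_E_walls_pos u₁ u₂ u₃ u₄ v₁ v₂ S hS hσ h1 h3 a1 a2 a3 a4
    have t1 : 0 ≤ (y₁ - yV) * (2 * u₁ ^ 2 - S) := mul_nonneg (by linarith) a1.le
    have t2 : 0 ≤ (y₂ - yV) * (2 * u₂ ^ 2 - S) := mul_nonneg (by linarith) a2.le
    have t3 : 0 ≤ (y₃ - yV) * (2 * u₃ ^ 2 - S) := mul_nonneg (by linarith) a3.le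
    have t4 : 0 ≤ (y₄ - yV) * (2 * u₄ ^ 2 - S) := mul_nonneg (by linarith) a4.le
    have t5 : 0 ≤ (yV - y₅) * (2 * v₁ ^ 2 - S) := mul_nonneg (by linarith) a5.le
    have t6 : 0 ≤ (yV - y₆) * (2 * v₂ ^ 2 - S) := mul_nonneg (by linarith) a6.le
    -- all terms are ≥ 0 and sum to 0, so each vanishes; walls ≠ 0 ⇒ heights = 0, contradicting `hoff`
    have e1 := height_zero_of_mul_wall _ _ (ne_of_gt a1) (le_antisymm (by linarith) t1 : (y₁ - yV) * (2 * u₁ ^ 2 - S) = 0)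
    have e2 := height_zero_of_mul_wall _ _ (ne_of_gt a2) (le_antisymm (by linarith) t2 : (y₂ - yV) * (2 * u₂ ^ 2 - S) = 0)
    have e3 := height_zero_of_mul_wall _ _ (ne_of_gt a3) (le_antisymm (by linarith) t3 : (y₃ - yV) * (2 * u₃ ^ 2 - S) = 0)
    have e4 := height_zero_of_mul_wall _ _ (ne_of_gt a4) (le_antisymm (by linarith) t4 : (y₄ - yV) * (2 * u₄ ^ 2 - S) = 0)
    have e5 := height_zero_of_mul_wall _ _ (ne_of_gt a5) (le_antisymm (by linarith) t5 : (yV - y₅) * (2 * v₁ ^ 2 - S) = 0)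
    have e6 := height_zero_of_mul_wall _ _ (ne_of_gt a6) (le_antisymm (by linarith) t6 : (yV - y₆) * (2 * v₂ ^ 2 - S) = 0)
    linarith
  · rintro ⟨a1, a2, a3, a4⟩
    obtain ⟨a5, a6⟩ := F_walls_neg_of_E_walls_neg u₁ u₂ u₃ u₄ v₁ v₂ S hS hσ h1 h3 a1 a2 a3 a4
    have t1 : (y₁ - yV) * (2 * u₁ ^ 2 - S) ≤ 0 := mul_nonpos_of_nonneg_of_nonpos (by linarith) a1.le
    have t2 : (y₂ - yV) * (2 * u₂ ^ 2 - S) ≤ 0 := mul_nonpos_of_nonneg_of_nonpos (by linarith) a2.le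
    have t3 : (y₃ - yV) * (2 * u₃ ^ 2 - S) ≤ 0 := mul_nonpos_of_nonneg_of_nonpos (by linarith) a3.le
    have t4 : (y₄ - yV) * (2 * u₄ ^ 2 - S) ≤ 0 := mul_nonpos_of_nonneg_of_nonpos (by linarith) a4.le
    have t5 : (yV - y₅) * (2 * v₁ ^ 2 - S) ≤ 0 := mul_nonpos_of_nonneg_of_nonpos (by linarith) a5.le
    have t6 : (yV - y₆) * (2 * v₂ ^ 2 - S) ≤ 0 := mul_nonpos_of_nonneg_of_nonpos (by linarith) a6.le
    have e1 := height_zero_of_mul_wall _ _ (ne_of_lt a1) (le_antisymm t1 (by linarith) : (y₁ - yV) * (2 * u₁ ^ 2 - S) = 0)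
    have e2 := height_zero_of_mul_wall _ _ (ne_of_lt a2) (le_antisymm t2 (by linarith) : (y₂ - yV) * (2 * u₂ ^ 2 - S) = 0)
    have e3 := height_zero_of_mul_wall _ _ (ne_of_lt a3) (le_antisymm t3 (by linarith) : (y₃ - yV) * (2 * u₃ ^ 2 - S) = 0)
    have e4 := height_zero_of_mul_wall _ _ (ne_of_lt a4) (le_antisymm t4 (by linarith) : (y₄ - yV) * (2 * u₄ ^ 2 - S) = 0)
    have e5 := height_zero_of_mul_wall _ _ (ne_of_lt a5) (le_antisymm t5 (by linarith) : (yV - y₅) * (2 * v₁ ^ 2 - S) = 0)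
    have e6 := height_zero_of_mul_wall _ _ (ne_of_lt a6) (le_antisymm t6 (by linarith) : (yV - y₆) * (2 * v₂ ^ 2 - S) = 0)
    linarith
  · -- parity: σ⁴∏w = 16∏(pair sums)² ≥ 0
    have hσ4 : 0 < (u₁ + u₂ + u₃ + u₄) ^ 4 := by positivity
    have key : (u₁ + u₂ + u₃ + u₄) ^ 4 * ((2 * u₁ ^ 2 - S) * (2 * u₂ ^ 2 - S) * (2 * u₃ ^ 2 - S) * (2 * u₄ ^ 2 - S))
        = ((u₁ + u₂ + u₃ + u₄) * (2 * u₁ ^ 2 - S)) * ((u₁ + u₂ + u₃ + u₄) * (2 * u₂ ^ 2 - S))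
          * ((u₁ + u₂ + u₃ + u₄) * (2 * u₃ ^ 2 - S)) * ((u₁ + u₂ + u₃ + u₄) * (2 * u₄ ^ 2 - S)) := by ring
    have hnn : 0 ≤ (u₁ + u₂ + u₃ + u₄) ^ 4
        * ((2 * u₁ ^ 2 - S) * (2 * u₂ ^ 2 - S) * (2 * u₃ ^ 2 - S) * (2 * u₄ ^ 2 - S)) := by
      rw [key, w1, w2, w3, w4]
      have : 2 * ((u₁ + u₂) * (u₁ + u₃) * (u₁ + u₄)) * (2 * ((u₂ + u₁) * (u₂ + u₃) * (u₂ + u₄)))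
          * (2 * ((u₃ + u₁) * (u₃ + u₂) * (u₃ + u₄))) * (2 * ((u₄ + u₁) * (u₄ + u₂) * (u₄ + u₃)))
          = 16 * ((u₁ + u₂) * (u₁ + u₃) * (u₁ + u₄) * (u₂ + u₃) * (u₂ + u₄) * (u₃ + u₄)) ^ 2 := by ring
      rw [this]; positivity
    exact (mul_nonneg_iff_of_pos_left hσ4).mp hnn

end Summit.HodgeConjecture.HodgeConjecture.WeilClassTestSignLaw
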